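import Literature.Analysis.FunctionSpaces.BMOCarlesonFeffermanStein
import Literature.Analysis.FunctionSpaces.BMOJohnNirenberg
import HarnessLib

/-!
# `BMO` modulo constants embeds in the weighted space `L²((1 + |x|)^{-(d+2)} dx)`

Analysis/FunctionSpaces **proofs file** (theorems only: no definitions, no named facts, no
`sorry`). For `f ∈ BMO(E)`, `E` a finite-dimensional real inner product space of dimension `d`,
the normalised function `f − f_{B(x,1)}` satisfies

  `∫ |f(z) − f_{B(x,1)}|² (1 + ‖z − x‖)^{-(d+2)} dz ≤ C_E ‖f‖²_{BMO}`

(`exists_lintegral_enorm_sub_average_sq_mul_weight_le`). This is the `L²` companion of the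
weighted `L¹` oscillation estimate of Grafakos, *Modern Fourier Analysis*, Prop. 3.1.5 (ii)
(tree: `bmo_weighted_oscillation_le`, `BMOBesovProofs`), obtained from the John–Nirenberg
inequality in `L²` form (Grafakos, Cor. 3.1.9; tree:
`exists_lintegral_ball_enorm_sub_average_sq_le` fed with `john_nirenberg_holds`) on the dyadic
balls `B(x, 2^k)`, the telescoping of ball averages `|f_{B(x,2^k)} − f_{B(x,1)}| ≤ k 2^d ‖f‖_*`
(`MemBMO.abs_average_ball_two_pow_mul_sub_le`), and the summation over the shells
`B(x, 2^{k+1}) ∖ B(x, 2^k)`, on which the weight is `≤ 2^{-k(d+2)}` (the pattern of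
`MemBMO.lintegral_compl_ball_enorm_sub_average_mul_le`, `BMOCarlesonFeffermanStein`):

* `exists_lintegral_ball_two_pow_enorm_sub_average_sq_le` (and its real form `…_ofReal`) —
  `∫_{B(x,2^k r)} |f − f_{B(x,r)}|² ≤ C (k+1)² ‖f‖²_* |B(x, 2^k r)|`;
* `exists_lintegral_shell_enorm_sub_average_sq_mul_weight_le` — one shell contributes
  `≤ C ‖f‖²_* 2^{-k}`;
* `exists_lintegral_enorm_sub_average_sq_mul_weight_le` — the weighted bound.

Purpose: bounded sequences in `BMO` become, after subtracting the unit-ball averages, bounded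
sequences in the Hilbert space `L²((1 + |x|)^{-(d+2)} dx)` (a finite measure), where the tree's
weak sequential compactness (`exists_subseq_tendsto_integral_mul_of_lintegral_rpow_le'`,
`WeakCompactnessLpFinite`) applies; this is how `L^∞_t BMO_x` stream functions are carried to
blow-up limits (Lei–Zhang 2011, proof of Thm. 1.4: "the stream function … is scaling invariant.
Thus the stream function of `u` is in BMO").

## Mathlib / tree search

Reused: `exists_lintegral_ball_enorm_sub_average_sq_le`, `compl_ball_subset_iUnion_shell`
(`BMOCarlesonFeffermanStein`), `john_nirenberg_holds` (`BMOJohnNirenberg`),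
`MemBMO.abs_average_ball_two_pow_mul_sub_le` (`BMOCarlesonFeffermanStein`); Mathlib
`Measure.addHaar_ball_of_pos`, `lintegral_iUnion_le`, `lintegral_add_compl`,
`ENNReal.ofReal_tsum_of_nonneg`, `tsum_geometric_two`.
`lean search 'BMO.*sq.*weight|weighted.*BMO'`: only the `L¹` weighted estimates of
`BMOBesovProofs` / `BMOCarlesonProofs`.

## References

* L. Grafakos, *Modern Fourier Analysis*, 3rd ed. (2014), Prop. 3.1.5 (ii), Cor. 3.1.9.
  [GrafakosMFA2014]
* F. John, L. Nirenberg, *On functions of bounded mean oscillation*, Comm. Pure Appl. Math. 14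
  (1961), Lemma 1'. [JohnNirenberg1961]
-/

noncomputable section

open MeasureTheory Set Function Filter Metric
open _root_.Topology
open scoped NNReal ENNReal

namespace Literature.Analysis.FunctionSpaces

universe u

variable {E : Type u} [NormedAddCommGroup E] [InnerProductSpace ℝ E] [FiniteDimensional ℝ E]
  [MeasurableSpace E] [BorelSpace E]

/-! ### Dyadic `L²` oscillation bounds -/

omit [NormedAddCommGroup E] [InnerProductSpace ℝ E] [FiniteDimensional ℝ E]
  [MeasurableSpace E] [BorelSpace E] in
/-- `(a - c)² ≤ 2 (a - b)² + 2 (b - c)²` in `ℝ≥0∞` through `‖·‖ₑ`. [folklore] -/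
theorem enorm_sub_sq_le_two_mul_add_two_mul (a b c : ℝ) :
    ‖a - c‖ₑ ^ 2 ≤ 2 * ‖a - b‖ₑ ^ 2 + 2 * ‖b - c‖ₑ ^ 2 := by
  have h : (a - c) ^ 2 ≤ 2 * (a - b) ^ 2 + 2 * (b - c) ^ 2 := by
    nlinarith [sq_nonneg (a - 2 * b + c)]
  have e : ∀ y : ℝ, ‖y‖ₑ ^ 2 = ENNReal.ofReal (y ^ 2) := fun y => by
    rw [Real.enorm_eq_ofReal_abs, ← ENNReal.ofReal_pow (abs_nonneg _), sq_abs]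
  rw [e, e, e, ← ENNReal.ofReal_ofNat 2, ← ENNReal.ofReal_mul (by norm_num),
    ← ENNReal.ofReal_mul (by norm_num), ← ENNReal.ofReal_add (by positivity) (by positivity)]
  exact ENNReal.ofReal_le_ofReal h

/-- **Dyadic `L²` oscillation bound.** There is a dimensional constant `C` such that for every
`f ∈ BMO(E)`, every centre `x`, radius `r > 0` and `k ∈ ℕ`,
`∫_{B(x, 2^k r)} |f − f_{B(x,r)}|² ≤ C (1 + k)² ‖f‖²_* |B(x, 2^k r)|`: the John–Nirenberg `L²`
bound on `B(x, 2^k r)` (`exists_lintegral_ball_enorm_sub_average_sq_le` with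
`john_nirenberg_holds`) and the telescoping `|f_{B(x,2^k r)} − f_{B(x,r)}| ≤ k 2^d ‖f‖_*`
(`MemBMO.abs_average_ball_two_pow_mul_sub_le`). [folklore] -/
theorem exists_lintegral_ball_two_pow_enorm_sub_average_sq_le :
    ∃ C : ℝ≥0, ∀ (f : E → ℝ), MemBMO f → ∀ (x : E) (r : ℝ), 0 < r → ∀ k : ℕ,
      ∫⁻ z in ball x (2 ^ k * r), ‖f z - ⨍ w in ball x r, f w‖ₑ ^ 2 ≤
        C * ((k : ℝ≥0∞) + 1) ^ 2 * eBMOSeminorm f ^ 2 * volume (ball x (2 ^ k * r)) := by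
  obtain ⟨C₁, hC₁⟩ := exists_lintegral_ball_enorm_sub_average_sq_le (E := E) john_nirenberg_holds
  set d : ℕ := Module.finrank ℝ E with hd
  refine ⟨2 * C₁ + 2 * (2 ^ d) ^ 2, fun f hf x r hr k => ?_⟩
  have hrk : (0 : ℝ) < 2 ^ k * r := by positivity
  set S : ℝ≥0∞ := eBMOSeminorm f with hS
  have hStop : S ≠ ∞ := hf.eBMOSeminorm_lt_top.ne
  set c : ℝ := ⨍ w in ball x r, f w with hc
  set ck : ℝ := ⨍ w in ball x (2 ^ k * r), f w with hck
  set V : ℝ≥0∞ := volume (ball x (2 ^ k * r)) with hV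
  -- pointwise splitting
  have hpt : ∀ z, ‖f z - c‖ₑ ^ 2 ≤ 2 * ‖f z - ck‖ₑ ^ 2 + 2 * ‖ck - c‖ₑ ^ 2 := fun z =>
    enorm_sub_sq_le_two_mul_add_two_mul (f z) ck c
  have hmeas : AEMeasurable (fun z => ‖f z - ck‖ₑ ^ 2) (volume.restrict (ball x (2 ^ k * r))) :=
    ((hf.1.aestronglyMeasurable.sub aestronglyMeasurable_const).restrict).enorm.pow_const 2
  have h1 : ∫⁻ z in ball x (2 ^ k * r), ‖f z - c‖ₑ ^ 2 ≤
      2 * (∫⁻ z in ball x (2 ^ k * r), ‖f z - ck‖ₑ ^ 2) + 2 * ‖ck - c‖ₑ ^ 2 * V := by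
    calc ∫⁻ z in ball x (2 ^ k * r), ‖f z - c‖ₑ ^ 2
        ≤ ∫⁻ z in ball x (2 ^ k * r), (2 * ‖f z - ck‖ₑ ^ 2 + 2 * ‖ck - c‖ₑ ^ 2) :=
          lintegral_mono fun z => hpt z
      _ = 2 * (∫⁻ z in ball x (2 ^ k * r), ‖f z - ck‖ₑ ^ 2) + 2 * ‖ck - c‖ₑ ^ 2 * V := by
          rw [lintegral_add_right' _ aemeasurable_const, lintegral_const_mul'' _ hmeas,
            lintegral_const, Measure.restrict_apply_univ]
  -- the John–Nirenberg term
  have h2 : ∫⁻ z in ball x (2 ^ k * r), ‖f z - ck‖ₑ ^ 2 ≤ C₁ * S ^ 2 * V := hC₁ f hf x _ hrk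
  -- the telescoping term
  have h3 : ‖ck - c‖ₑ ^ 2 ≤ ((k : ℝ≥0∞) + 1) ^ 2 * (2 ^ d) ^ 2 * S ^ 2 := by
    have hreal : |ck - c| ≤ k * (2 ^ d * S.toReal) := hf.abs_average_ball_two_pow_mul_sub_le x hr k
    have hreal' : |ck - c| ≤ (k + 1) * (2 ^ d * S.toReal) := by
      refine hreal.trans (mul_le_mul_of_nonneg_right (by linarith) ?_)
      exact mul_nonneg (by positivity) ENNReal.toReal_nonneg
    have e1 : ‖ck - c‖ₑ = ENNReal.ofReal |ck - c| := Real.enorm_eq_ofReal_abs _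
    have e2 : ENNReal.ofReal ((k + 1) * (2 ^ d * S.toReal)) = ((k : ℝ≥0∞) + 1) * 2 ^ d * S := by
      rw [ENNReal.ofReal_mul (by positivity), ENNReal.ofReal_mul (by positivity),
        ENNReal.ofReal_toReal hStop, ← mul_assoc]
      congr 2
      · rw [ENNReal.ofReal_add (by positivity) zero_le_one, ENNReal.ofReal_natCast,
          ENNReal.ofReal_one]
      · rw [ENNReal.ofReal_pow (by norm_num), ENNReal.ofReal_ofNat]
    calc ‖ck - c‖ₑ ^ 2 ≤ (ENNReal.ofReal ((k + 1) * (2 ^ d * S.toReal))) ^ 2 := by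
          rw [e1]; gcongr
      _ = ((k : ℝ≥0∞) + 1) ^ 2 * (2 ^ d) ^ 2 * S ^ 2 := by rw [e2]; ring
  -- combine
  calc ∫⁻ z in ball x (2 ^ k * r), ‖f z - c‖ₑ ^ 2
      ≤ 2 * (C₁ * S ^ 2 * V) + 2 * (((k : ℝ≥0∞) + 1) ^ 2 * (2 ^ d) ^ 2 * S ^ 2) * V := by
        refine h1.trans (add_le_add ?_ ?_)
        · gcongr
        · gcongr
    _ ≤ ((2 * C₁ + 2 * (2 ^ d) ^ 2 : ℝ≥0) : ℝ≥0∞) * ((k : ℝ≥0∞) + 1) ^ 2 * S ^ 2 * V := by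
        have hk1 : (1 : ℝ≥0∞) ≤ ((k : ℝ≥0∞) + 1) ^ 2 := by
          calc (1 : ℝ≥0∞) = 1 ^ 2 := by simp
            _ ≤ ((k : ℝ≥0∞) + 1) ^ 2 := by gcongr; exact le_add_self
        push_cast
        calc 2 * (C₁ * S ^ 2 * V) + 2 * (((k : ℝ≥0∞) + 1) ^ 2 * (2 ^ d) ^ 2 * S ^ 2) * V
            = (2 * C₁ * 1 + 2 * (2 ^ d) ^ 2 * ((k : ℝ≥0∞) + 1) ^ 2) * S ^ 2 * V := by ring
          _ ≤ (2 * C₁ * ((k : ℝ≥0∞) + 1) ^ 2 + 2 * (2 ^ d) ^ 2 * ((k : ℝ≥0∞) + 1) ^ 2) *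
              S ^ 2 * V := by
              gcongr
          _ = (2 * ↑C₁ + 2 * (2 ^ d) ^ 2) * ((k : ℝ≥0∞) + 1) ^ 2 * S ^ 2 * V := by ring


/-- Real form of the dyadic bound at unit base radius: with `s = ‖f‖_*` and `V₁ = |B(0,1)|`,
`∫_{B(x, 2^k)} |f − f_{B(x,1)}|² ≤ C (k+1)² s² 2^{kd} V₁`. [folklore] -/
theorem exists_lintegral_ball_two_pow_enorm_sub_average_sq_le_ofReal :
    ∃ C : ℝ≥0, ∀ (f : E → ℝ), MemBMO f → ∀ (x : E) (k : ℕ),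
      ∫⁻ z in ball x (2 ^ k), ‖f z - ⨍ w in ball x 1, f w‖ₑ ^ 2 ≤
        ENNReal.ofReal (C * ((k : ℝ) + 1) ^ 2 * (eBMOSeminorm f).toReal ^ 2 *
          ((2 : ℝ) ^ (k * Module.finrank ℝ E) * volume.real (ball (0 : E) 1))) := by
  obtain ⟨C, hC⟩ := exists_lintegral_ball_two_pow_enorm_sub_average_sq_le (E := E)
  refine ⟨C, fun f hf x k => ?_⟩
  have h := hC f hf x 1 one_pos k
  rw [mul_one] at h
  have hvol : volume (ball x ((2 : ℝ) ^ k)) =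
      ENNReal.ofReal ((2 : ℝ) ^ (k * Module.finrank ℝ E) * volume.real (ball (0 : E) 1)) := by
    rw [Measure.addHaar_ball_of_pos volume x (by positivity : (0 : ℝ) < 2 ^ k), ← pow_mul,
      measureReal_def, ENNReal.ofReal_mul (by positivity),
      ENNReal.ofReal_toReal measure_ball_lt_top.ne]
  have hk : ((k : ℝ≥0∞) + 1) = ENNReal.ofReal ((k : ℝ) + 1) := by
    rw [ENNReal.ofReal_add (by positivity) zero_le_one, ENNReal.ofReal_natCast, ENNReal.ofReal_one]
  have e : ENNReal.ofReal (C * ((k : ℝ) + 1) ^ 2 * (eBMOSeminorm f).toReal ^ 2 *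
      ((2 : ℝ) ^ (k * Module.finrank ℝ E) * volume.real (ball (0 : E) 1))) =
      C * ((k : ℝ≥0∞) + 1) ^ 2 * eBMOSeminorm f ^ 2 *
        ENNReal.ofReal ((2 : ℝ) ^ (k * Module.finrank ℝ E) * volume.real (ball (0 : E) 1)) := by
    rw [ENNReal.ofReal_mul (by positivity), ENNReal.ofReal_mul (by positivity),
      ENNReal.ofReal_mul (by positivity), ENNReal.ofReal_coe_nnreal,
      ENNReal.ofReal_pow (by positivity), ENNReal.ofReal_pow ENNReal.toReal_nonneg,
      ENNReal.ofReal_toReal hf.eBMOSeminorm_lt_top.ne, ← hk]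
  rw [e, ← hvol]
  exact h

omit [NormedAddCommGroup E] [InnerProductSpace ℝ E] [FiniteDimensional ℝ E]
  [MeasurableSpace E] [BorelSpace E] in
/-- `(k + 2)² ≤ 8 · 2^k`. [folklore] -/
theorem sq_add_two_le_eight_mul_two_pow (k : ℕ) : ((k : ℝ) + 2) ^ 2 ≤ 8 * 2 ^ k := by
  induction k with
  | zero => norm_num
  | succ n ih =>
    push_cast
    have h2 : (2 : ℝ) * n + 5 ≤ 8 * 2 ^ n := by
      have : (n : ℝ) + 1 ≤ 2 ^ n := by exact_mod_cast Nat.succ_le_of_lt n.lt_two_pow_self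
      nlinarith [this]
    calc ((n : ℝ) + 1 + 2) ^ 2 = ((n : ℝ) + 2) ^ 2 + (2 * n + 5) := by ring
      _ ≤ 8 * 2 ^ n + 8 * 2 ^ n := add_le_add ih h2
      _ = 8 * 2 ^ (n + 1) := by ring

/-- **One dyadic shell of the weighted `L²` estimate.** On `B(x, 2^{k+1}) ∖ B(x, 2^k)` the
weight `(1 + ‖z − x‖)^{-(d+2)}` is at most `2^{-k(d+2)}`, so the shell contributes at most
`C s² V₁ 2^d (k+2)² 4^{-k} ≤ 8 C s² V₁ 2^d 2^{-k}`. [folklore] -/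
theorem exists_lintegral_shell_enorm_sub_average_sq_mul_weight_le :
    ∃ C : ℝ≥0, ∀ (f : E → ℝ), MemBMO f → ∀ (x : E) (k : ℕ),
      ∫⁻ z in ball x (2 ^ (k + 1)) \ ball x (2 ^ k), ‖f z - ⨍ w in ball x 1, f w‖ₑ ^ 2 *
          ENNReal.ofReal (((1 + ‖z - x‖) ^ (Module.finrank ℝ E + 2))⁻¹) ≤
        ENNReal.ofReal (C * (eBMOSeminorm f).toReal ^ 2 * (1 / 2 : ℝ) ^ k) := by
  obtain ⟨C, hC⟩ := exists_lintegral_ball_two_pow_enorm_sub_average_sq_le_ofReal (E := E)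
  set d : ℕ := Module.finrank ℝ E with hd
  set V : ℝ := volume.real (ball (0 : E) 1) with hV
  have hV0 : 0 ≤ V := measureReal_nonneg
  refine ⟨⟨8 * C * 2 ^ d * V, by positivity⟩, fun f hf x k => ?_⟩
  set s : ℝ := (eBMOSeminorm f).toReal with hs
  have hs0 : 0 ≤ s := ENNReal.toReal_nonneg
  have hwk : 0 ≤ (((2 : ℝ) ^ k) ^ (d + 2))⁻¹ := by positivity
  -- the weight on the shell
  have step1 : ∫⁻ z in ball x (2 ^ (k + 1)) \ ball x (2 ^ k), ‖f z - ⨍ w in ball x 1, f w‖ₑ ^ 2 *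
        ENNReal.ofReal (((1 + ‖z - x‖) ^ (d + 2))⁻¹)
      ≤ ∫⁻ z in ball x (2 ^ (k + 1)) \ ball x (2 ^ k), ‖f z - ⨍ w in ball x 1, f w‖ₑ ^ 2 *
        ENNReal.ofReal ((((2 : ℝ) ^ k) ^ (d + 2))⁻¹) := by
    refine setLIntegral_mono' (measurableSet_ball.diff measurableSet_ball) fun z hz => ?_
    have hz' : (2 : ℝ) ^ k ≤ ‖z - x‖ := by
      have := hz.2
      rwa [mem_ball_iff_norm, not_lt] at this
    gcongr
    linarith
  have step2 : ∫⁻ z in ball x (2 ^ (k + 1)) \ ball x (2 ^ k), ‖f z - ⨍ w in ball x 1, f w‖ₑ ^ 2 *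
        ENNReal.ofReal ((((2 : ℝ) ^ k) ^ (d + 2))⁻¹)
      ≤ (∫⁻ z in ball x (2 ^ (k + 1)), ‖f z - ⨍ w in ball x 1, f w‖ₑ ^ 2) *
        ENNReal.ofReal ((((2 : ℝ) ^ k) ^ (d + 2))⁻¹) := by
    rw [← lintegral_mul_const' _ _ ENNReal.ofReal_ne_top]
    exact lintegral_mono_set Set.sdiff_subset
  have step3 : (∫⁻ z in ball x (2 ^ (k + 1)), ‖f z - ⨍ w in ball x 1, f w‖ₑ ^ 2) *
        ENNReal.ofReal ((((2 : ℝ) ^ k) ^ (d + 2))⁻¹) ≤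
      ENNReal.ofReal (C * (((k + 1 : ℕ) : ℝ) + 1) ^ 2 * s ^ 2 * ((2 : ℝ) ^ ((k + 1) * d) * V)) *
        ENNReal.ofReal ((((2 : ℝ) ^ k) ^ (d + 2))⁻¹) := by
    gcongr
    exact hC f hf x (k + 1)
  have step4 :
      ENNReal.ofReal (C * (((k + 1 : ℕ) : ℝ) + 1) ^ 2 * s ^ 2 * ((2 : ℝ) ^ ((k + 1) * d) * V)) *
        ENNReal.ofReal ((((2 : ℝ) ^ k) ^ (d + 2))⁻¹) ≤
      ENNReal.ofReal ((8 * C * 2 ^ d * V) * s ^ 2 * (1 / 2 : ℝ) ^ k) := by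
    rw [← ENNReal.ofReal_mul' hwk]
    refine ENNReal.ofReal_le_ofReal ?_
    have hk2 := sq_add_two_le_eight_mul_two_pow k
    have h2k : (0 : ℝ) < 2 ^ k := by positivity
    -- `C (k+2)² s² 2^{(k+1)d} V 2^{-k(d+2)} = C s² V 2^d (k+2)² 4^{-k} ≤ 8 C 2^d V s² 2^{-k}`
    have e1 : C * (((k + 1 : ℕ) : ℝ) + 1) ^ 2 * s ^ 2 * ((2 : ℝ) ^ ((k + 1) * d) * V) *
        (((2 : ℝ) ^ k) ^ (d + 2))⁻¹ =
          C * 2 ^ d * V * s ^ 2 * (((k : ℝ) + 2) ^ 2 * ((2 : ℝ) ^ k)⁻¹ ^ 2) := by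
      push_cast
      have : (2 : ℝ) ^ ((k + 1) * d) = (2 ^ k) ^ d * 2 ^ d := by
        rw [add_mul, one_mul, pow_add, pow_mul]
      rw [this]
      field_simp
      ring
    rw [e1]
    have e2 : (8 * C * 2 ^ d * V) * s ^ 2 * (1 / 2 : ℝ) ^ k =
        C * 2 ^ d * V * s ^ 2 * (8 * ((2 : ℝ) ^ k)⁻¹) := by
      rw [one_div, inv_pow]; ring
    rw [e2]
    refine mul_le_mul_of_nonneg_left ?_ (by positivity)
    calc ((k : ℝ) + 2) ^ 2 * ((2 : ℝ) ^ k)⁻¹ ^ 2 ≤ 8 * 2 ^ k * ((2 : ℝ) ^ k)⁻¹ ^ 2 := by gcongr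
      _ = 8 * ((2 : ℝ) ^ k)⁻¹ := by field_simp
  exact step1.trans (step2.trans (step3.trans step4))


/-- **`BMO` modulo constants lies in the weighted `L²` space `L²((1 + |z − x|)^{-(d+2)} dz)`,
with norm controlled by `‖f‖_*`.** There is a dimensional constant `C` such that for every
`f ∈ BMO(E)` and every centre `x`,
`∫ |f(z) − f_{B(x,1)}|² (1 + ‖z − x‖)^{-(d+2)} dz ≤ C ‖f‖²_*` (John–Nirenberg in `L²` form on the
dyadic balls `B(x, 2^k)`, the telescoping of ball averages, and the summation of the shells
`B(x,2^{k+1}) ∖ B(x,2^k)` where the weight is `≤ 2^{-k(d+2)}`; Grafakos, *Modern Fourier Analysis*,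
Prop. 3.1.5 (ii) is the `L¹` analogue with weight `(1 + |x|)^{-(d+1)}`). This is the uniform bound
through which bounded sequences in `BMO` become bounded sequences in a Hilbert space.
[cite: GrafakosMFA2014, Proposition 3.1.5 (ii) and Corollary 3.1.9] -/
theorem exists_lintegral_enorm_sub_average_sq_mul_weight_le :
    ∃ C : ℝ≥0, ∀ (f : E → ℝ), MemBMO f → ∀ (x : E),
      ∫⁻ z, ‖f z - ⨍ w in ball x 1, f w‖ₑ ^ 2 *
          ENNReal.ofReal (((1 + ‖z - x‖) ^ (Module.finrank ℝ E + 2))⁻¹) ≤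
        ENNReal.ofReal (C * (eBMOSeminorm f).toReal ^ 2) := by
  obtain ⟨C₀, hC₀⟩ := exists_lintegral_ball_two_pow_enorm_sub_average_sq_le_ofReal (E := E)
  obtain ⟨C₁, hC₁⟩ := exists_lintegral_shell_enorm_sub_average_sq_mul_weight_le (E := E)
  set d : ℕ := Module.finrank ℝ E with hd
  set V : ℝ := volume.real (ball (0 : E) 1) with hV
  have hV0 : 0 ≤ V := measureReal_nonneg
  refine ⟨⟨C₀ * V + 2 * C₁, by positivity⟩, fun f hf x => ?_⟩
  set s : ℝ := (eBMOSeminorm f).toReal with hs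
  have hs0 : 0 ≤ s := ENNReal.toReal_nonneg
  set g : E → ℝ≥0∞ := fun z => ‖f z - ⨍ w in ball x 1, f w‖ₑ ^ 2 *
    ENNReal.ofReal (((1 + ‖z - x‖) ^ (d + 2))⁻¹) with hg
  -- the inner ball
  have hin : ∫⁻ z in ball x 1, g z ≤ ENNReal.ofReal (C₀ * s ^ 2 * V) := by
    calc ∫⁻ z in ball x 1, g z ≤ ∫⁻ z in ball x 1, ‖f z - ⨍ w in ball x 1, f w‖ₑ ^ 2 * 1 := by
          refine lintegral_mono fun z => ?_
          simp only [hg]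
          gcongr
          rw [← ENNReal.ofReal_one]
          refine ENNReal.ofReal_le_ofReal (inv_le_one_of_one_le₀ (one_le_pow₀ ?_))
          linarith [norm_nonneg (z - x)]
      _ ≤ ENNReal.ofReal (C₀ * ((0 : ℕ) + 1 : ℝ) ^ 2 * s ^ 2 * ((2 : ℝ) ^ (0 * d) * V)) := by
          simpa only [mul_one, pow_zero] using hC₀ f hf x 0
      _ = ENNReal.ofReal (C₀ * s ^ 2 * V) := by norm_num
  -- the shells
  have hterm : ∀ k : ℕ, 0 ≤ C₁ * s ^ 2 * (1 / 2 : ℝ) ^ k := fun k => by positivity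
  have hsum : Summable fun k : ℕ => C₁ * s ^ 2 * (1 / 2 : ℝ) ^ k :=
    (summable_geometric_of_lt_one (by norm_num) (by norm_num)).mul_left _
  have hout : ∫⁻ z in (ball x 1)ᶜ, g z ≤ ENNReal.ofReal (2 * C₁ * s ^ 2) := by
    have hcover : (ball x 1)ᶜ ⊆ ⋃ k : ℕ, (ball x (2 ^ (k + 1)) \ ball x (2 ^ k)) := by
      have h := compl_ball_subset_iUnion_shell x (one_pos : (0:ℝ) < 1)
      simpa only [mul_one] using h
    calc ∫⁻ z in (ball x 1)ᶜ, g z ≤ ∫⁻ z in ⋃ k : ℕ, (ball x (2 ^ (k + 1)) \ ball x (2 ^ k)), g z :=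
          lintegral_mono_set hcover
      _ ≤ ∑' k : ℕ, ∫⁻ z in ball x (2 ^ (k + 1)) \ ball x (2 ^ k), g z := lintegral_iUnion_le _ _
      _ ≤ ∑' k : ℕ, ENNReal.ofReal (C₁ * s ^ 2 * (1 / 2 : ℝ) ^ k) :=
          ENNReal.tsum_le_tsum fun k => hC₁ f hf x k
      _ = ENNReal.ofReal (∑' k : ℕ, C₁ * s ^ 2 * (1 / 2 : ℝ) ^ k) :=
          (ENNReal.ofReal_tsum_of_nonneg hterm hsum).symm
      _ = ENNReal.ofReal (2 * C₁ * s ^ 2) := by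
          rw [tsum_mul_left, tsum_geometric_two]; ring_nf
  -- assemble
  calc ∫⁻ z, g z = (∫⁻ z in ball x 1, g z) + ∫⁻ z in (ball x 1)ᶜ, g z :=
        (lintegral_add_compl g measurableSet_ball).symm
    _ ≤ ENNReal.ofReal (C₀ * s ^ 2 * V) + ENNReal.ofReal (2 * C₁ * s ^ 2) := add_le_add hin hout
    _ = ENNReal.ofReal ((C₀ * V + 2 * C₁) * s ^ 2) := by
        rw [← ENNReal.ofReal_add (by positivity) (by positivity)]; ring_nf

end Literature.Analysis.FunctionSpaces
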